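import Summits.AtomisticToContinuum.FouriersLaw.Theses.EmbeddedDrudeMourre
import Summits.AtomisticToContinuum.FouriersLaw.Theorems.EmbeddedDrudeMourreAbelOfSpectralDensity
import Summits.AtomisticToContinuum.FouriersLaw.Theorems.EmbeddedDrudeMourreMourreDissolutionOfKineticCorner
import Summits.AtomisticToContinuum.FouriersLaw.Theorems.EmbeddedDrudeMourreDrudeDissolutionStubBmRigidity
import Summits.AtomisticToContinuum.FouriersLaw.Theorems.KineticCornerStationaryCorrelationBound

/-!
# The Poisson sandwich at the natural scale `T²` — composition theorems of line `natural-scale-poisson-sandwich`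
(crux `EmbeddedDrudeMourre.DrudeDissolution`, stmt-AtomisticToContinuum-12593; `--supports` file, closes nothing)

Durable (sorry-free) part of the line's skeleton `Cruxes/DrudeDissolution/Lines/natural_scale_poisson_sandwich.lean`
(planner `planner-cruxplan-stmt-AtomisticToContinuum-12593-natural-scale-poisso-0`, v3; lead a1): the crux
`DrudeDissolution` (a continuous current spectral density `g_T` with `g_T(0) > 0` for the weakly anharmonic pinned chain at
small temperature `T`) is reduced to the conjunction of

* **F** (frequency side, the registered stub `stub_windowModulusAtScale`; research-open): a window density of the current
  spectral measure on `(−c₀T², c₀T²)` with `T`-uniform bound `K` and `T`-uniform modulus `m(c)` at the origin at scale `T²`,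
  for some Buttà–Marchioro-class pair `(μ, D)` (the total mass `σ(ℝ) = C_T(0) ≤ B T²` comes from the landed
  `KineticCorner.stationaryCorrelationBound_proof`, stmt-3435);
* **T** (time side, the registered stub `stub_kineticAbelFloor`; research-open in `d = 1`): a `T`-uniform floor
  `a₀ ≤ ∫₀^∞ e^{−νT²t} C_T(t) dt` for `ν ∈ (0, ν₀]`, `T < T₀(ν)`,

by the Poisson-kernel upper bound `∫ ν'/(ν'²+ω²) dσ ≤ π·M + 2δ(ν'/ρ²)·M' + (ν'/δ²)·σ(ℝ)` (`abelMean_le_of_window`) at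
`ν' = νT²`, `δ = c₀T²`, `ρ = cT²`, where every term is `T`-independent (`spectralWitnesses_of_sandwich`,
`drudeDissolution_of_windowModulus_of_kineticAbelFloor`). The time side T follows from route KineticCorner's `KineticLimit`
(stmt-AtomisticToContinuum-3431) through the LANDED Abel-summation lemma B
(`NaturalScalePoissonSandwich.stub_abelFloor_of_windowLimits`, p132245) and rigidity of the BM class
(`kineticAbelFloor_of_bmKineticLimit`, `kineticAbelFloor_of_kineticLimit`), hence
`drudeDissolution_of_windowModulus_of_kineticLimit : F → KineticLimit → DrudeDissolution`.
Both hypotheses F and T are written out verbatim (the registered stub signatures); nothing is assumed as a `def`.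
-/

noncomputable section

open MeasureTheory Filter Set Function
open scoped Topology ENNReal

namespace Summit.AtomisticToContinuum.FouriersLaw.Theorems.DrudeDissolution.NaturalScalePoissonSandwich

open Literature.MathematicalPhysics.KineticTheory.HeatConduction

/-! ## The Poisson sandwich (pure analysis) -/

/-- **Poisson sandwich, upper half.** For a finite measure `σ` on `ℝ` which on the window `(−δ, δ)` is Lebesgue measure
with a continuous density `g`, `0 ≤ g ≤ M'` there and `g ≤ M` on the inner window `(−ρ, ρ)` (`ρ > 0`; only `ρ ≤ δ` is
useful), `0 ≤ M, M'`, and `ν > 0`: `∫ ν/(ν²+ω²) dσ(ω) ≤ π·M + 2δ·(ν/ρ²)·M' + (ν/δ²)·σ(ℝ)` (inner window: Poisson mass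
`≤ π`; annulus: `ν/(ν²+ω²) ≤ ν/ρ²` on a set of Lebesgue measure `≤ 2δ`; outside: `≤ ν/δ²`). The matching lower bound
`m·2arctan(ρ/ν) ≤ ∫ ν/(ν²+ω²) dσ` (`g ≥ m` on the inner window) is not needed by the line. [folklore] -/
theorem abelMean_le_of_window (σ : Measure ℝ) [IsFiniteMeasure σ] {δ ρ ν M M' : ℝ}
    (hδ : 0 < δ) (hρ : 0 < ρ) (hν : 0 < ν) (hM : 0 ≤ M) (hM' : 0 ≤ M')
    {g : ℝ → ℝ} (hgc : ContinuousOn g (Ioo (-δ) δ)) (hg0 : ∀ ω ∈ Ioo (-δ) δ, 0 ≤ g ω)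
    (hgM' : ∀ ω ∈ Ioo (-δ) δ, g ω ≤ M') (hgM : ∀ ω ∈ Ioo (-ρ) ρ, g ω ≤ M)
    (hσ : σ.restrict (Ioo (-δ) δ) = (volume.restrict (Ioo (-δ) δ)).withDensity fun ω => ENNReal.ofReal (g ω)) :
    ∫ ω, ν / (ν ^ 2 + ω ^ 2) ∂σ ≤ Real.pi * M + 2 * δ * (ν / ρ ^ 2) * M' + ν / δ ^ 2 * σ.real univ := by
  set P : ℝ → ℝ := fun ω => ν / (ν ^ 2 + ω ^ 2) with hP
  obtain ⟨hPint, hPtot⟩ := Theorems.AbelOfSpectralDensity.integrable_poisson_and_integral_eq_pi hν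
  have hPpos : ∀ ω, 0 ≤ P ω := fun ω => by positivity
  have hPc : Continuous P := by
    refine continuous_const.div (by fun_prop) (fun ω => ?_)
    positivity
  have hPle : ∀ ω, P ω ≤ 1 / ν := fun ω => by
    simp only [hP]
    rw [div_le_div_iff₀ (by positivity) hν, one_mul]
    nlinarith [sq_nonneg ω]
  -- `P` is `σ`-integrable
  have hPσ : Integrable P σ := by
    refine (integrable_const (1 / ν)).mono' hPc.aestronglyMeasurable (ae_of_all _ (fun ω => ?_))
    rw [Real.norm_eq_abs, abs_of_nonneg (hPpos ω)]
    exact hPle ω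
  -- the density on the window
  have hgm : AEMeasurable g (volume.restrict (Ioo (-δ) δ)) :=
    (hgc.aestronglyMeasurable measurableSet_Ioo).aemeasurable
  have hgi : IntegrableOn g (Ioo (-δ) δ) :=
    Theorems.AbelOfSpectralDensity.integrableOn_of_restrict_eq_withDensity hgc hg0 hσ
  have hS : volume (Ioo (-δ) δ) ≠ ∞ := by
    rw [Real.volume_Ioo]; exact ENNReal.ofReal_ne_top
  have hPg : IntegrableOn (fun ω => P ω * g ω) (Ioo (-δ) δ) :=
    Integrable.bdd_mul hgi hPc.aestronglyMeasurable (ae_of_all _ (fun ω => by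
      rw [Real.norm_eq_abs, abs_of_nonneg (hPpos ω)]; exact hPle ω))
  -- pointwise bound on the window: inner part by `M·P`, annulus by `(ν/ρ²)·M'`
  have hbound : ∀ ω ∈ Ioo (-δ) δ, P ω * g ω ≤ M * P ω + ν / ρ ^ 2 * M' := by
    intro ω hω
    have h2 : 0 ≤ ν / ρ ^ 2 * M' := by positivity
    have h3 : 0 ≤ M * P ω := mul_nonneg hM (hPpos ω)
    by_cases hin : ω ∈ Ioo (-ρ) ρ
    · have h1 : P ω * g ω ≤ P ω * M := mul_le_mul_of_nonneg_left (hgM ω hin) (hPpos ω)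
      linarith [mul_comm (P ω) M]
    · have hρω : ρ ^ 2 ≤ ω ^ 2 := by
        simp only [mem_Ioo, not_and_or, not_lt] at hin
        rcases hin with h | h
        · have h' : ρ ^ 2 ≤ (-ω) ^ 2 := pow_le_pow_left₀ hρ.le (by linarith) 2
          rw [neg_sq] at h'
          exact h'
        · exact pow_le_pow_left₀ hρ.le h 2
      have hω2 : 0 < ω ^ 2 := lt_of_lt_of_le (by positivity) hρω
      have hPω : P ω ≤ ν / ρ ^ 2 :=
        calc P ω ≤ ν / ω ^ 2 := div_le_div_of_nonneg_left hν.le hω2 (by nlinarith)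
          _ ≤ ν / ρ ^ 2 := div_le_div_of_nonneg_left hν.le (by positivity) hρω
      have h1 : P ω * g ω ≤ ν / ρ ^ 2 * M' := mul_le_mul hPω (hgM' ω hω) (hg0 ω hω) (by positivity)
      linarith
  -- the window part
  have hwin : ∫ ω in Ioo (-δ) δ, P ω * g ω ≤ Real.pi * M + 2 * δ * (ν / ρ ^ 2) * M' := by
    have hPM : IntegrableOn (fun ω => M * P ω) (Ioo (-δ) δ) := (hPint.const_mul M).integrableOn
    have hcst : IntegrableOn (fun _ : ℝ => ν / ρ ^ 2 * M') (Ioo (-δ) δ) := integrableOn_const hS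
    have hrhs : IntegrableOn (fun ω => M * P ω + ν / ρ ^ 2 * M') (Ioo (-δ) δ) := hPM.add hcst
    have hwinP : ∫ ω in Ioo (-δ) δ, P ω ≤ Real.pi :=
      calc ∫ ω in Ioo (-δ) δ, P ω ≤ ∫ ω, P ω := setIntegral_le_integral hPint (ae_of_all _ hPpos)
        _ = Real.pi := hPtot
    have hvol : (volume : Measure ℝ).real (Ioo (-δ) δ) = 2 * δ := by
      rw [Real.volume_real_Ioo_of_le (by linarith)]; ring
    calc ∫ ω in Ioo (-δ) δ, P ω * g ω ≤ ∫ ω in Ioo (-δ) δ, (M * P ω + ν / ρ ^ 2 * M') :=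
          setIntegral_mono_on hPg hrhs measurableSet_Ioo hbound
      _ = M * (∫ ω in Ioo (-δ) δ, P ω) + (volume : Measure ℝ).real (Ioo (-δ) δ) * (ν / ρ ^ 2 * M') := by
          rw [integral_add hPM hcst, integral_const_mul, setIntegral_const, smul_eq_mul]
      _ ≤ M * Real.pi + 2 * δ * (ν / ρ ^ 2 * M') := by
          rw [hvol]
          exact add_le_add (mul_le_mul_of_nonneg_left hwinP hM) le_rfl
      _ = Real.pi * M + 2 * δ * (ν / ρ ^ 2) * M' := by ring
  -- the part outside the window
  have hout : ∫ ω in (Ioo (-δ) δ)ᶜ, P ω ∂σ ≤ ν / δ ^ 2 * σ.real univ :=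
    (Real.le_norm_self _).trans (Theorems.AbelOfSpectralDensity.norm_setIntegral_poisson_compl_le σ hδ hν.le)
  -- assemble
  rw [← integral_add_compl (μ := σ) measurableSet_Ioo hPσ,
    Theorems.AbelOfSpectralDensity.setIntegral_eq_of_restrict_eq_withDensity hg0 hgm hσ P]
  linarith

/-! ## The quarter budget: F ∧ T at one parameter point ⇒ spectral witnesses -/

/-- **The sandwich composition at one parameter point.** If the frequency side F and the time side T hold for
`pinnedChain ω₂ lam β γ` (all `> 0`), then spectral witnesses exist for all small `T`: choose `c ≤ c₀` with
`π m(c) ≤ a₀/4` (`m → 0`), then `ν ≤ ν₀` with `2c₀Kν/c² ≤ a₀/4` and `B⁺ν/c₀² ≤ a₀/4` (`B⁺ = max B 1`, `B` the constant of the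
PROVED a-priori bound `|C_T| ≤ BT²`, `KineticCorner.stationaryCorrelationBound_proof`, stmt-3435), then
`T < min T₀ᶠ T₀ᵗ(ν) T₁ᵇ`; at such `T` the F-pair, the T-pair and the canonical datum (`MourreDissolution.canonicalDatum`) have the
same `C_T` by rigidity (`LineSketch.stub_bmRigidity`); `σ(ℝ) = C_T(0) ≤ BT²` (`Negative.cosine_zero`);
`∫₀^∞e^{−νT²t}C_T = ∫ ν'/(ν'²+ω²)dσ` (`integral_exp_neg_mul_cosTransform`, `ν' = νT²`) and `abelMean_le_of_window` give
`a₀ ≤ π g(0) + 3a₀/4`, so `g(0) > 0`; the witness is the canonical datum with F's `σ, g` and `δ = c₀T²`. [folklore] -/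
theorem spectralWitnesses_of_sandwich {ω₂ lam β γ : ℝ} (hω : 0 < ω₂) (hl : 0 < lam) (hβ : 0 < β) (hγ : 0 < γ)
    (hF : ∃ (c₀ K T₀ : ℝ) (m : ℝ → ℝ), 0 < c₀ ∧ 0 < K ∧ 0 < T₀ ∧
        Filter.Tendsto m (nhdsWithin 0 (Set.Ioi 0)) (nhds 0) ∧
        ∀ T : ℝ, 0 < T → T < T₀ →
          ∃ (μ : Measure ChainConfig) (D : InfiniteChainDynamics (pinnedChain ω₂ lam β γ)),
            (pinnedChain ω₂ lam β γ).IsChainGibbsMeasure T μ ∧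
            MeasurePreserving (fun σ : ChainConfig => fun i : ℤ => σ (i + 1)) μ μ ∧
            D.carrier = (pinnedChain ω₂ lam β γ).bmGood ∧
            D.PreservesMeasure μ ∧
            ∃ σ : Measure ℝ, IsFiniteMeasure σ ∧
              (∀ t : ℝ, D.currentCorrelation μ t = ∫ ω, Real.cos (ω * t) ∂σ) ∧
              ∃ g : ℝ → ℝ, ContinuousOn g (Ioo (-(c₀ * T ^ 2)) (c₀ * T ^ 2)) ∧
                (∀ ω ∈ Ioo (-(c₀ * T ^ 2)) (c₀ * T ^ 2), 0 ≤ g ω) ∧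
                (∀ ω ∈ Ioo (-(c₀ * T ^ 2)) (c₀ * T ^ 2), g ω ≤ K) ∧
                (∀ c : ℝ, 0 < c → c ≤ c₀ → ∀ ω ∈ Ioo (-(c * T ^ 2)) (c * T ^ 2), |g ω - g 0| ≤ m c) ∧
                σ.restrict (Ioo (-(c₀ * T ^ 2)) (c₀ * T ^ 2)) =
                  (volume.restrict (Ioo (-(c₀ * T ^ 2)) (c₀ * T ^ 2))).withDensity fun ω => ENNReal.ofReal (g ω))
    (hT : ∃ a₀ ν₀ : ℝ, 0 < a₀ ∧ 0 < ν₀ ∧ ∀ ν : ℝ, 0 < ν → ν ≤ ν₀ →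
        ∃ T₀ : ℝ, 0 < T₀ ∧ ∀ T : ℝ, 0 < T → T < T₀ →
          ∃ (μ : Measure ChainConfig) (D : InfiniteChainDynamics (pinnedChain ω₂ lam β γ)),
            (pinnedChain ω₂ lam β γ).IsChainGibbsMeasure T μ ∧
            MeasurePreserving (fun σ : ChainConfig => fun i : ℤ => σ (i + 1)) μ μ ∧
            D.carrier = (pinnedChain ω₂ lam β γ).bmGood ∧
            D.PreservesMeasure μ ∧
            a₀ ≤ ∫ t in Ioi (0 : ℝ), Real.exp (-(ν * T ^ 2 * t)) * D.currentCorrelation μ t) :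
    ∃ T₀ : ℝ, 0 < T₀ ∧ ∀ T : ℝ, 0 < T → T < T₀ →
      ∃ (μT : Measure ChainConfig) (D : InfiniteChainDynamics (pinnedChain ω₂ lam β γ)),
        (pinnedChain ω₂ lam β γ).IsChainGibbsMeasure T μT ∧ D.PreservesMeasure μT ∧
          (∀ t : ℝ, D.HasAbsConvergentCorrelation μT t) ∧
            ∃ σ : Measure ℝ, IsFiniteMeasure σ ∧
              (∀ t : ℝ, D.currentCorrelation μT t = ∫ ω, Real.cos (ω * t) ∂σ) ∧
                ∃ (δ : ℝ) (g : ℝ → ℝ), 0 < δ ∧ ContinuousOn g (Ioo (-δ) δ) ∧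
                  (∀ ω ∈ Ioo (-δ) δ, 0 ≤ g ω) ∧ 0 < g 0 ∧
                    σ.restrict (Ioo (-δ) δ) =
                      (volume.restrict (Ioo (-δ) δ)).withDensity fun ω => ENNReal.ofReal (g ω) := by
  obtain ⟨c₀, K, T₀F, m, hc₀, hK, hT₀F, hm, hFw⟩ := hF
  obtain ⟨a₀, ν₀, ha₀, hν₀, hTw⟩ := hT
  -- the a-priori bound `|C_T| ≤ B T²` (stmt-3435, PROVED) controls the total spectral mass `σ(ℝ) = C_T(0)`
  obtain ⟨B, T₁b, hT₁b, hSCB⟩ := Theorems.KineticCorner.stationaryCorrelationBound_proof ω₂ lam β γ hω hl hβ hγ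
  obtain ⟨Bp, hBp, hBBp⟩ : ∃ Bp : ℝ, 0 < Bp ∧ B ≤ Bp := ⟨max B 1, lt_max_of_lt_right one_pos, le_max_left _ _⟩
  -- Step 1: the inner scale `c ∈ (0, c₀]` with `π·m(c) ≤ a₀/4`
  obtain ⟨c, hc, hcc₀, hmc⟩ : ∃ c : ℝ, 0 < c ∧ c ≤ c₀ ∧ Real.pi * m c ≤ a₀ / 4 := by
    have h1 : ∀ᶠ x in 𝓝[>] (0 : ℝ), m x < a₀ / (4 * Real.pi) := hm (Iio_mem_nhds (by positivity))
    have h2 : ∀ᶠ x in 𝓝[>] (0 : ℝ), x ∈ Ioo 0 c₀ := Ioo_mem_nhdsGT hc₀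
    obtain ⟨c, hc1, hc2⟩ := (h1.and h2).exists
    refine ⟨c, hc2.1, hc2.2.le, ?_⟩
    have h3 : Real.pi * m c ≤ Real.pi * (a₀ / (4 * Real.pi)) :=
      mul_le_mul_of_nonneg_left hc1.le Real.pi_pos.le
    have h4 : Real.pi * (a₀ / (4 * Real.pi)) = a₀ / 4 := by
      field_simp
    linarith
  -- Step 2: the Abel parameter `ν ∈ (0, ν₀]` with both `ν`-terms of the sandwich `≤ a₀/4`
  obtain ⟨ν, hν, hνν₀, hν1, hν2⟩ : ∃ ν : ℝ, 0 < ν ∧ ν ≤ ν₀ ∧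
      2 * c₀ * K * ν / c ^ 2 ≤ a₀ / 4 ∧ Bp * ν / c₀ ^ 2 ≤ a₀ / 4 := by
    refine ⟨min ν₀ (min (a₀ * c ^ 2 / (8 * c₀ * K)) (a₀ * c₀ ^ 2 / (4 * Bp))),
      lt_min hν₀ (lt_min (by positivity) (by positivity)), min_le_left _ _, ?_, ?_⟩
    · have hle : min ν₀ (min (a₀ * c ^ 2 / (8 * c₀ * K)) (a₀ * c₀ ^ 2 / (4 * Bp))) ≤ a₀ * c ^ 2 / (8 * c₀ * K) :=
        (min_le_right _ _).trans (min_le_left _ _)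
      calc 2 * c₀ * K * min ν₀ (min (a₀ * c ^ 2 / (8 * c₀ * K)) (a₀ * c₀ ^ 2 / (4 * Bp))) / c ^ 2
          ≤ 2 * c₀ * K * (a₀ * c ^ 2 / (8 * c₀ * K)) / c ^ 2 := by gcongr
        _ = a₀ / 4 := by field_simp; ring
    · have hle : min ν₀ (min (a₀ * c ^ 2 / (8 * c₀ * K)) (a₀ * c₀ ^ 2 / (4 * Bp))) ≤ a₀ * c₀ ^ 2 / (4 * Bp) :=
        (min_le_right _ _).trans (min_le_right _ _)
      calc Bp * min ν₀ (min (a₀ * c ^ 2 / (8 * c₀ * K)) (a₀ * c₀ ^ 2 / (4 * Bp))) / c₀ ^ 2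
          ≤ Bp * (a₀ * c₀ ^ 2 / (4 * Bp)) / c₀ ^ 2 := by gcongr
        _ = a₀ / 4 := by field_simp
  -- Step 3: the temperature threshold
  obtain ⟨T₀T, hT₀T, hTw'⟩ := hTw ν hν hνν₀
  refine ⟨min (min T₀F T₀T) T₁b, lt_min (lt_min hT₀F hT₀T) hT₁b, fun T hTpos hTlt => ?_⟩
  have hTF : T < T₀F := hTlt.trans_le ((min_le_left _ _).trans (min_le_left _ _))
  have hTT : T < T₀T := hTlt.trans_le ((min_le_left _ _).trans (min_le_right _ _))
  have hTb : T < T₁b := hTlt.trans_le (min_le_right _ _)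
  have hT2 : 0 < T ^ 2 := by positivity
  obtain ⟨μ₁, D₁, hG₁, hsh₁, hD₁, hP₁, σ, hσfin, hCσ, g, hgc, hg0, hgK, hmod, hres⟩ := hFw T hTpos hTF
  obtain ⟨μ₂, D₂, hG₂, hsh₂, hD₂, hP₂, hfloor⟩ := hTw' T hTpos hTT
  -- the canonical datum at `T` and rigidity of the BM class
  obtain ⟨D, hD, hshD, hZ⟩ := Theorems.MourreDissolution.canonicalDatum ω₂ lam β γ hω hl hβ
  obtain ⟨Z, hG, -, -, hsc⟩ := hZ T hTpos
  have hgood := Theorems.MourreDissolution.goodTriple_of_canonicalDatum hshD Z hG hsc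
  have hC₁ : ∀ t, D₁.currentCorrelation μ₁ t = D.currentCorrelation Z.μ t :=
    (Theorems.DrudeDissolution.LineSketch.stub_bmRigidity ω₂ lam β γ hω hl hβ hγ T μ₁ Z.μ D₁ D hTpos hG₁ hG
      hsh₁ hgood.2.2.2.2.1 hD₁ hD hP₁).2.2
  have hC₂ : ∀ t, D₂.currentCorrelation μ₂ t = D.currentCorrelation Z.μ t :=
    (Theorems.DrudeDissolution.LineSketch.stub_bmRigidity ω₂ lam β γ hω hl hβ hγ T μ₂ Z.μ D₂ D hTpos hG₂ hG
      hsh₂ hgood.2.2.2.2.1 hD₂ hD hP₂).2.2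
  have hCσ' : ∀ t, D.currentCorrelation Z.μ t = ∫ ω, Real.cos (ω * t) ∂σ := fun t => (hC₁ t).symm.trans (hCσ t)
  haveI := hσfin
  -- total spectral mass: `σ(ℝ) = C_T(0) ≤ B T² ≤ B⁺ T²`
  have hmass : σ.real univ ≤ Bp * T ^ 2 := by
    rw [← Theorems.DrudeDissolution.Negative.cosine_zero hCσ']
    exact (le_abs_self _).trans ((hSCB T Z.μ D hTpos hTb hgood 0 le_rfl).trans
      (mul_le_mul_of_nonneg_right hBBp hT2.le))
  -- Step 4: the sandwich at `ν' = ν T²`, window `c₀T²`, inner window `cT²`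
  have hν' : 0 < ν * T ^ 2 := by positivity
  have hδpos : 0 < c₀ * T ^ 2 := by positivity
  have hρpos : 0 < c * T ^ 2 := by positivity
  have h0mem : (0 : ℝ) ∈ Ioo (-(c₀ * T ^ 2)) (c₀ * T ^ 2) := ⟨by linarith, hδpos⟩
  have h0mem' : (0 : ℝ) ∈ Ioo (-(c * T ^ 2)) (c * T ^ 2) := ⟨by linarith, hρpos⟩
  have hg00 : 0 ≤ g 0 := hg0 0 h0mem
  have hmc0 : 0 ≤ m c := by
    have h := hmod c hc hcc₀ 0 h0mem'
    rw [sub_self, abs_zero] at h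
    exact h
  have hgM : ∀ ω ∈ Ioo (-(c * T ^ 2)) (c * T ^ 2), g ω ≤ g 0 + m c := by
    intro ω hω
    have h := (abs_le.mp (hmod c hc hcc₀ ω hω)).2
    linarith
  -- Abel mean of `σ` = Laplace transform of the canonical `C_T`, which carries the floor
  have hA : ∫ t in Ioi (0 : ℝ), Real.exp (-(ν * T ^ 2 * t)) * D.currentCorrelation Z.μ t =
      ∫ ω, ν * T ^ 2 / ((ν * T ^ 2) ^ 2 + ω ^ 2) ∂σ := by
    have e : (fun t => Real.exp (-(ν * T ^ 2 * t)) * D.currentCorrelation Z.μ t) =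
        fun t => Real.exp (-(ν * T ^ 2 * t)) * ∫ ω, Real.cos (ω * t) ∂σ := by
      funext t; rw [hCσ' t]
    rw [e]
    exact Theorems.AbelOfSpectralDensity.integral_exp_neg_mul_cosTransform σ hν'
  have hfl : a₀ ≤ ∫ ω, ν * T ^ 2 / ((ν * T ^ 2) ^ 2 + ω ^ 2) ∂σ := by
    rw [← hA]
    simp only [hC₂] at hfloor
    exact hfloor
  have hup := abelMean_le_of_window σ (M := g 0 + m c) (M' := K) hδpos hρpos hν' (by positivity) hK.le
    hgc hg0 hgK hgM hres
  -- the three error terms at the natural scale are `T`-independent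
  have e1 : 2 * (c₀ * T ^ 2) * (ν * T ^ 2 / (c * T ^ 2) ^ 2) * K = 2 * c₀ * K * ν / c ^ 2 := by
    field_simp
  have e2 : ν * T ^ 2 / (c₀ * T ^ 2) ^ 2 * σ.real univ ≤ Bp * ν / c₀ ^ 2 := by
    calc ν * T ^ 2 / (c₀ * T ^ 2) ^ 2 * σ.real univ ≤ ν * T ^ 2 / (c₀ * T ^ 2) ^ 2 * (Bp * T ^ 2) :=
          mul_le_mul_of_nonneg_left hmass (by positivity)
      _ = Bp * ν / c₀ ^ 2 := by field_simp
  have hπg : a₀ / 4 ≤ Real.pi * g 0 := by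
    rw [e1] at hup
    nlinarith [hup, e2, hfl, hmc, hν1, hν2, Real.pi_pos]
  have hgpos : 0 < g 0 := by
    by_contra h
    push Not at h
    have h0 : g 0 = 0 := le_antisymm h hg00
    rw [h0, mul_zero] at hπg
    linarith
  -- the witness: the canonical datum, F's spectral measure and density, window `c₀T²`
  exact ⟨Z.μ, D, hG, hgood.2.1, hgood.2.2.1, σ, hσfin, hCσ', c₀ * T ^ 2, g, hδpos, hgc, hg0, hgpos, hres⟩

/-! ## Composition: the crux from F and T -/

/-- **F → T → crux.** The frequency side F (window density with a `T`-uniform modulus at scale `T²`, the registered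
stub `stub_windowModulusAtScale` verbatim) and the time side T (kinetic Abel floor, the registered stub
`stub_kineticAbelFloor` verbatim) imply `EmbeddedDrudeMourre.DrudeDissolution`, by `spectralWitnesses_of_sandwich` at
every admissible parameter point. [folklore] -/
theorem drudeDissolution_of_windowModulus_of_kineticAbelFloor :
    (∀ ω₂ lam β γ : ℝ, 0 < ω₂ → 0 < lam → 0 < β → 0 < γ → ∃ (c₀ K T₀ : ℝ) (m : ℝ → ℝ), 0 < c₀ ∧ 0 < K ∧ 0 < T₀ ∧
      Filter.Tendsto m (nhdsWithin 0 (Set.Ioi 0)) (nhds 0) ∧ ∀ T : ℝ, 0 < T → T < T₀ → ∃ (μ : MeasureTheory.Measure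
      Literature.MathematicalPhysics.KineticTheory.HeatConduction.ChainConfig) (D :
      Literature.MathematicalPhysics.KineticTheory.HeatConduction.InfiniteChainDynamics
      (Literature.MathematicalPhysics.KineticTheory.HeatConduction.pinnedChain ω₂ lam β γ)),
      (Literature.MathematicalPhysics.KineticTheory.HeatConduction.pinnedChain ω₂ lam β γ).IsChainGibbsMeasure T μ ∧
      MeasureTheory.MeasurePreserving (fun σ :
      Literature.MathematicalPhysics.KineticTheory.HeatConduction.ChainConfig => fun i : ℤ => σ (i + 1)) μ μ ∧
      D.carrier = (Literature.MathematicalPhysics.KineticTheory.HeatConduction.pinnedChain ω₂ lam β γ).bmGood ∧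
      D.PreservesMeasure μ ∧ ∃ σ : MeasureTheory.Measure ℝ, MeasureTheory.IsFiniteMeasure σ ∧ (∀ t : ℝ,
      D.currentCorrelation μ t = ∫ ω, Real.cos (ω * t) ∂σ) ∧ ∃ g : ℝ → ℝ, ContinuousOn g (Set.Ioo (-(c₀ * T ^ 2))
      (c₀ * T ^ 2)) ∧ (∀ ω ∈ Set.Ioo (-(c₀ * T ^ 2)) (c₀ * T ^ 2), 0 ≤ g ω) ∧ (∀ ω ∈ Set.Ioo (-(c₀ * T ^ 2)) (c₀ * T
      ^ 2), g ω ≤ K) ∧ (∀ c : ℝ, 0 < c → c ≤ c₀ → ∀ ω ∈ Set.Ioo (-(c * T ^ 2)) (c * T ^ 2), |g ω - g 0| ≤ m c) ∧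
      σ.restrict (Set.Ioo (-(c₀ * T ^ 2)) (c₀ * T ^ 2)) = (MeasureTheory.volume.restrict (Set.Ioo (-(c₀ * T ^ 2))
      (c₀ * T ^ 2))).withDensity fun ω => ENNReal.ofReal (g ω)) →
    (∀ ω₂ lam β γ : ℝ, 0 < ω₂ → 0 < lam → 0 < β → 0 < γ → ∃ a₀ ν₀ : ℝ, 0 < a₀ ∧ 0 < ν₀ ∧ ∀ ν : ℝ, 0 < ν → ν ≤ ν₀ →
      ∃ T₀ : ℝ, 0 < T₀ ∧ ∀ T : ℝ, 0 < T → T < T₀ → ∃ (μ : MeasureTheory.Measure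
      Literature.MathematicalPhysics.KineticTheory.HeatConduction.ChainConfig) (D :
      Literature.MathematicalPhysics.KineticTheory.HeatConduction.InfiniteChainDynamics
      (Literature.MathematicalPhysics.KineticTheory.HeatConduction.pinnedChain ω₂ lam β γ)),
      (Literature.MathematicalPhysics.KineticTheory.HeatConduction.pinnedChain ω₂ lam β γ).IsChainGibbsMeasure T μ ∧
      MeasureTheory.MeasurePreserving (fun σ :
      Literature.MathematicalPhysics.KineticTheory.HeatConduction.ChainConfig => fun i : ℤ => σ (i + 1)) μ μ ∧
      D.carrier = (Literature.MathematicalPhysics.KineticTheory.HeatConduction.pinnedChain ω₂ lam β γ).bmGood ∧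
      D.PreservesMeasure μ ∧ a₀ ≤ ∫ t in Set.Ioi (0 : ℝ), Real.exp (-(ν * T ^ 2 * t)) * D.currentCorrelation μ t) →
    Summit.AtomisticToContinuum.FouriersLaw.Theses.EmbeddedDrudeMourre.DrudeDissolution :=
  fun hF hT ω₂ lam β γ hω hl hβ hγ =>
    spectralWitnesses_of_sandwich hω hl hβ hγ (hF ω₂ lam β γ hω hl hβ hγ) (hT ω₂ lam β γ hω hl hβ hγ)

end Summit.AtomisticToContinuum.FouriersLaw.Theorems.DrudeDissolution.NaturalScalePoissonSandwich

end
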